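import Literature.Probability.Percolation.CoveringLiftStructure
import Literature.Probability.Percolation.CoveringExploration
import HarnessLib

/-!
# The lifted exploration on the cover `𝒢` (Martineau–Severo 2019, §5): coins, bookkeeping and strategy

Tenth file of the inline proof of `Literature.Probability.Percolation.MartineauSevero2019_cor22`.
Martineau–Severo (Ann. Probab. 47 (2019), §5) answer the queries of the exploration of `ℋ = 𝒢/Γ` (the machine
of `CoveringExploration.lean`) by reading coins of the cover: a `p`-explored `ℋ`-edge `e` is given a designated
lift `e'` at the current lift of its explored endpoint and "for every `k ≤ M`, `η_{(e',k)} := ω_{(e,k)}`" (here: the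
edge query reads the `M` copies of `e'`); an `s`-exploration at `u`, with `x` the lift of `u`, reads one fresh
copy of each `p`-unexplored edge of the structure `Z(x,r)` and of one `p`-unexplored lift of each tree edge to
`S_{r+1}(u)` (Lemma 5.1: "at least two vertices adjacent to `Z`", Condition 1: "at most one lift is
`p`-explored"), the copy being guaranteed unused by Condition 4 and the value of `M`. This file sets up that
side:

* `GCoin V M = (Sym2 V × Fin M) ⊕ ℕ` — the `M` copies of the pairs of `𝒢` and a pool of padding coins (so
  that a bonus always reads exactly `T` coins; the pool is independent of everything and only equalises the
  shapes of the queries); `gOmega c = {f | ∃ k, (f,k) ∈ c}` (`∨_k η_{(f,k)}`, a `p = 1-(1-q)^M` percolation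
  on `𝒢` after intersecting with `E(𝒢)`).
* `copyIdx` — an injective numbering of `B_{r+1}(w)` by `Fin M` for every `w` (this replaces M–S's "smallest
  `s`-unexplored label": the copy of an edge `f` read by the bonus at `u` is indexed by the position of `u` in
  the ball around the anchor `anchor f` of `f`, and distinct bonus centres get distinct copies).
* `GState` (current lifts `lift : W → V` of explored vertices — M–S's `C'` with the surjection `π : C' → C` of
  Condition 5 —, designated lifts `dl` of queried edges — Condition 1 —, and the pool counter), `nbrOver`
  (weak lifting), `bonusEdgeSet` / `bonusCoins` (the coins of an `s`-exploration: non-designated edges of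
  `Z(x) =` tame walk `∪` lifted geodesics `∪` their translates, one non-designated boundary lift per
  `b ∈ S_{r+1}(u)`, padded to `T`), `gEncode`, `gstep`, `gstateOf`, and the strategy `gStrategy`.
* `shape_gStrategy_eq` — after every transcript the `𝒢`-query has the same shape as the `ℋ`-query (so that
  `CoinTranscript.measureReal_setOf_run_eq` applies once freshness is established in the sequel file).

## References

* S. Martineau, F. Severo, Ann. Probab. 47 (2019), §5 (Structure of the process, Conditions 1–5, Steps
  `2K+1`, `2K+2`, Step ∞), Lemma 5.1 [MartineauSevero2019].
-/

noncomputable section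

namespace Literature.Probability.Percolation

open Literature.Barriers.CriticalPhenomena
open scoped Classical

variable {V : Type*} {Γ : Type*} [Group Γ] [MulAction Γ V]

/-! ### Coins on the cover -/

/-- The `𝒢`-side coins: `M` copies of each pair of vertices of `𝒢` (the multigraph `Ĝ`), and a pool `ℕ` of
padding coins. [cite: MartineauSevero2019, §5 (the multigraph Ĝ with edge-set E(𝒢) × {1,…,M})] -/
abbrev GCoin (V : Type*) (M : ℕ) : Type _ := (Sym2 V × Fin M) ⊕ ℕ

/-- The decoded open pairs of the cover: `η_f = ∨_k η_{(f,k)}` ("a `p`-explored edge of `𝒢` is open if at least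
one of its copies is `η`-open"). [cite: MartineauSevero2019, §5 ("(∨_k η_{e,k})_e, which is a p-bond-percolation on 𝒢")] -/
def gOmega {M : ℕ} (c : Set (GCoin V M)) : Set (Sym2 V) := {f | ∃ k : Fin M, (Sum.inl (f, k) : GCoin V M) ∈ c}

/-- The `M` copies of a pair, as coins. [cite: MartineauSevero2019, §5 ({e'} × {1,…,M})] -/
def copyCoins (M : ℕ) (f : Sym2 V) : Finset (GCoin V M) :=
  (Finset.univ : Finset (Fin M)).map ⟨fun k => Sum.inl (f, k), fun k k' h => by simpa using h⟩

/-- Membership in `copyCoins`. [folklore] -/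
@[simp] theorem mem_copyCoins {M : ℕ} {f : Sym2 V} {i : GCoin V M} :
    i ∈ copyCoins M f ↔ ∃ k : Fin M, i = Sum.inl (f, k) := by
  simp [copyCoins, eq_comm]

/-- `|copyCoins| = M`. [folklore] -/
@[simp] theorem card_copyCoins (M : ℕ) (f : Sym2 V) : (copyCoins M f : Finset (GCoin V M)).card = M := by
  simp [copyCoins]

/-- `n` consecutive padding coins starting at `p₀`. [folklore] -/
def padCoins (M : ℕ) (p₀ n : ℕ) : Finset (GCoin V M) :=
  (Finset.range n).map ⟨fun j => Sum.inr (p₀ + j), fun j j' h => by simpa using h⟩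

/-- Membership in `padCoins`. [folklore] -/
@[simp] theorem mem_padCoins {M p₀ n : ℕ} {i : GCoin V M} :
    i ∈ padCoins M p₀ n ↔ ∃ j, j < n ∧ i = Sum.inr (p₀ + j) := by
  simp [padCoins, eq_comm]

/-- `|padCoins p₀ n| = n`. [folklore] -/
@[simp] theorem card_padCoins (M p₀ n : ℕ) : (padCoins M p₀ n : Finset (GCoin V M)).card = n := by
  simp [padCoins]

/-! ### Copy indices and anchors -/

section Copies

variable (H : SimpleGraph (MulAction.orbitRel.Quotient Γ V)) [H.LocallyFinite] (r M : ℕ) [NeZero M]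

/-- **The copy index** of the bonus centre `u` relative to the vertex `w`: the position of `u` in a fixed
numbering of `B_{r+1}(w)` (junk `0` outside the ball or beyond `M`). [cite: MartineauSevero2019, §5 (Condition 4: "the number of s-explored edges (e',k) is at most the number of s-explored vertices u at distance at most r")] -/
def copyIdx (w u : MulAction.orbitRel.Quotient Γ V) : Fin M :=
  if h : u ∈ ballFin H w (r + 1) then
    if h' : ((ballFin H w (r + 1)).equivFin ⟨u, h⟩ : ℕ) < M then ⟨_, h'⟩ else 0
  else 0

variable {H r M}

/-- `copyIdx w` is injective on `B_{r+1}(w)` as soon as `|B_{r+1}(w)| ≤ M`. [cite: MartineauSevero2019, §5 (the value of M)] -/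
theorem copyIdx_injOn {w : MulAction.orbitRel.Quotient Γ V} (hM : (ballFin H w (r + 1)).card ≤ M)
    {u u' : MulAction.orbitRel.Quotient Γ V} (hu : u ∈ ballFin H w (r + 1)) (hu' : u' ∈ ballFin H w (r + 1))
    (h : copyIdx H r M w u = copyIdx H r M w u') : u = u' := by
  unfold copyIdx at h
  have hlt : ((ballFin H w (r + 1)).equivFin ⟨u, hu⟩ : ℕ) < M := lt_of_lt_of_le (Fin.is_lt _) hM
  have hlt' : ((ballFin H w (r + 1)).equivFin ⟨u', hu'⟩ : ℕ) < M := lt_of_lt_of_le (Fin.is_lt _) hM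
  rw [dif_pos hu, dif_pos hu', dif_pos hlt, dif_pos hlt'] at h
  have h2 : ((ballFin H w (r + 1)).equivFin ⟨u, hu⟩ : ℕ) = (ballFin H w (r + 1)).equivFin ⟨u', hu'⟩ := by
    have := congrArg Fin.val h
    simpa using this
  have h3 : (ballFin H w (r + 1)).equivFin ⟨u, hu⟩ = (ballFin H w (r + 1)).equivFin ⟨u', hu'⟩ := Fin.ext h2
  have h4 := (ballFin H w (r + 1)).equivFin.injective h3
  simpa using h4

end Copies

/-- **The anchor** of a pair of vertices of `𝒢`: the orbit of a fixed endpoint. [folklore] -/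
def anchor (Γ : Type*) [Group Γ] [MulAction Γ V] (f : Sym2 V) : MulAction.orbitRel.Quotient Γ V :=
  qmk Γ f.out.1

/-- The anchor is the orbit of an endpoint. [folklore] -/
theorem exists_mem_anchor_eq (f : Sym2 V) : ∃ z ∈ f, anchor Γ f = qmk Γ z :=
  ⟨f.out.1, Sym2.out_fst_mem f, rfl⟩

/-! ### The bookkeeping of the cover -/

/-- The `𝒢`-side bookkeeping: the current lift of each (explored) vertex of `ℋ` (M–S's `C'`, with `π`
surjecting `C'` onto `C`: Condition 5), the designated lift of each (queried) `ℋ`-edge (Condition 1), and the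
number of padding coins used. [cite: MartineauSevero2019, §5 (Conditions 1, 5; C'_{ℓ,n})] -/
structure GState (V : Type*) (Γ : Type*) [Group Γ] [MulAction Γ V] where
  /-- the current lift of a vertex of `ℋ` (junk off the explored set) -/
  lift : MulAction.orbitRel.Quotient Γ V → V
  /-- the designated lift of an `ℋ`-edge (junk off the queried set) -/
  dl : Sym2 (MulAction.orbitRel.Quotient Γ V) → Sym2 V
  /-- padding coins used so far -/
  pool : ℕ

namespace GState

/-- The initial bookkeeping: the origin `o = π x₀` is lifted to `x₀` (Step 0: `C'_0 = {o'}`).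
[cite: MartineauSevero2019, §5 (Step 0)] -/
def init (x₀ : V) : GState V Γ := ⟨fun _ => x₀, fun _ => s(x₀, x₀), 0⟩

end GState

section Lift

variable (G : SimpleGraph V)

/-- **Weak lifting, chosen**: a neighbour of `x` above `v` (junk `x` if there is none). [cite: MartineauSevero2019, §2 (weak lifting property)] -/
def nbrOver (x : V) (v : MulAction.orbitRel.Quotient Γ V) : V :=
  if h : ∃ y, G.Adj x y ∧ qmk Γ y = v then h.choose else x

variable {G}

/-- The chosen neighbour is a neighbour above `v` whenever `π x ∼ v`. [cite: MartineauSevero2019, §2 (weak lifting property)] -/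
theorem nbrOver_spec (hact : IsActionByAut G Γ) {x : V} {v : MulAction.orbitRel.Quotient Γ V}
    (h : (orbitQuotientGraph G Γ).Adj (qmk Γ x) v) : G.Adj x (nbrOver G x v) ∧ qmk Γ (nbrOver G x v) = v := by
  have hex : ∃ y, G.Adj x y ∧ qmk Γ y = v := exists_adj_of_quot_adj hact h
  rw [nbrOver, dif_pos hex]
  exact hex.choose_spec

end Lift

/-! ### The coins of an `s`-exploration -/

section Bonus

variable {G : SimpleGraph V} [(orbitQuotientGraph G Γ).LocallyFinite]
variable (hact : IsActionByAut G Γ) (hG : G.Connected) {r : ℕ}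
variable (htame : ∀ x : V, ∃ g : Γ, g ≠ 1 ∧ g • x ∈ graphBall G x r) (M T : ℕ) [NeZero M]

/-- The boundary lift at `x` towards `b ∈ S_{r+1}(π x)` (membership supplies the distance hypothesis).
[cite: MartineauSevero2019, Lemma 5.1] -/
def sphereBLift (x : V) (b : ↥(sphereFin (orbitQuotientGraph G Γ) (qmk Γ x) (r + 1))) :
    BLift G Γ r x b.1 :=
  bLift hact hG x b.1 ((mem_sphereFin_iff (quot_connected hG)).1 b.2)

/-- **The edges of `Z(x)`**: the tame walk `x → g x`, and for each `b ∈ S_{r+1}(π x)` the lifted geodesic and its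
translate by `g` (a connected structure inside `π⁻¹(B_r(π x))` off which two lifts of each tree edge hang).
[cite: MartineauSevero2019, Lemma 5.1 (the set Z' ⊆ Z(x,r))] -/
def zEdges (x : V) : Finset (Sym2 V) :=
  (tameLift htame x).walk.edges.toFinset ∪
    (sphereFin (orbitQuotientGraph G Γ) (qmk Γ x) (r + 1)).attach.biUnion fun b =>
      (sphereBLift hact hG x b).walk.edges.toFinset ∪
        (smulWalk hact (tameLift htame x).g (sphereBLift hact hG x b).walk).edges.toFinset

/-- A pair of `𝒢` is **designated** in the current bookkeeping: it is the designated lift of a queried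
`ℋ`-edge. [cite: MartineauSevero2019, §5 (Condition 1)] -/
def IsDesig (σ : EState (MulAction.orbitRel.Quotient Γ V)) (γ : GState V Γ) (f : Sym2 V) : Prop :=
  ∃ e ∈ σ.Q, γ.dl e = f

/-- **The boundary edge read for `b`**: the first boundary lift, unless it is designated, in which case its
translate ("there is at least one lift `e′` of `e` that is adjacent to `Z(x,r)` and `p`-unexplored").
[cite: MartineauSevero2019, §5 (Substep choosing e')] -/
def boundaryChoice (σ : EState (MulAction.orbitRel.Quotient Γ V)) (γ : GState V Γ) (x : V)
    (b : ↥(sphereFin (orbitQuotientGraph G Γ) (qmk Γ x) (r + 1))) : Sym2 V :=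
  if IsDesig σ γ (sphereBLift hact hG x b).edge₁ then (sphereBLift hact hG x b).edge₂ (tameLift htame x).g
  else (sphereBLift hact hG x b).edge₁

/-- The far endpoint (above `b`) of the boundary edge read for `b`. [cite: MartineauSevero2019, §5 (C'_{2K+2,n+1} contains the e')] -/
def boundaryFar (σ : EState (MulAction.orbitRel.Quotient Γ V)) (γ : GState V Γ) (x : V)
    (b : ↥(sphereFin (orbitQuotientGraph G Γ) (qmk Γ x) (r + 1))) : V :=
  if IsDesig σ γ (sphereBLift hact hG x b).edge₁ then (tameLift htame x).g • (sphereBLift hact hG x b).far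
  else (sphereBLift hact hG x b).far

/-- **The edges read by the `s`-exploration at `x`**: the non-designated edges of `Z(x)` and one boundary edge
per `b ∈ S_{r+1}(π x)`. [cite: MartineauSevero2019, §5 (Substeps of Step 2K+2)] -/
def bonusEdgeSet (σ : EState (MulAction.orbitRel.Quotient Γ V)) (γ : GState V Γ) (x : V) : Finset (Sym2 V) :=
  ((zEdges hact hG htame x).filter fun f => ¬ IsDesig σ γ f) ∪
    (sphereFin (orbitQuotientGraph G Γ) (qmk Γ x) (r + 1)).attach.image (boundaryChoice hact hG htame σ γ x)

/-- The coins of those edges: the copy indexed by the position of the bonus centre `π x` around the anchor.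
[cite: MartineauSevero2019, §5 ("take its s-unexplored copy (e',k) of smallest label k")] -/
def bonusEdgeCoins (σ : EState (MulAction.orbitRel.Quotient Γ V)) (γ : GState V Γ) (x : V) : Finset (GCoin V M) :=
  (bonusEdgeSet hact hG htame σ γ x).image fun f =>
    Sum.inl (f, copyIdx (orbitQuotientGraph G Γ) r M (anchor Γ f) (qmk Γ x))

/-- **The coins of the `s`-exploration at `x`**, padded to exactly `T` coins from the pool.
[cite: MartineauSevero2019, §5 (Step 2K+2; "set α_u := 1 with probability s/q")] -/
def bonusCoins (σ : EState (MulAction.orbitRel.Quotient Γ V)) (γ : GState V Γ) (x : V) : Finset (GCoin V M) :=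
  bonusEdgeCoins hact hG htame M σ γ x ∪ padCoins M γ.pool (T - (bonusEdgeCoins hact hG htame M σ γ x).card)

variable {hact hG htame M T}

/-- Edge coins and padding coins are disjoint. [folklore] -/
theorem disjoint_bonusEdgeCoins_padCoins (σ : EState (MulAction.orbitRel.Quotient Γ V)) (γ : GState V Γ) (x : V)
    (p₀ n : ℕ) : Disjoint (bonusEdgeCoins hact hG htame M σ γ x) (padCoins M p₀ n) := by
  rw [Finset.disjoint_left]
  intro i hi hi'
  obtain ⟨f, -, rfl⟩ := Finset.mem_image.1 hi
  obtain ⟨j, -, hj⟩ := mem_padCoins.1 hi'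
  cases hj

/-- **A bonus reads exactly `T` coins** as soon as `T` bounds `|Z(x)| + |S_{r+1}(π x)|`.
[cite: MartineauSevero2019, §5 ("q ≥ p̂^{|E(B_{3r}(x))|} ≥ s")] -/
theorem card_bonusCoins (σ : EState (MulAction.orbitRel.Quotient Γ V)) (γ : GState V Γ) (x : V)
    (hT : (zEdges hact hG htame x).card + (sphereFin (orbitQuotientGraph G Γ) (qmk Γ x) (r + 1)).card ≤ T) :
    (bonusCoins hact hG htame M T σ γ x).card = T := by
  have hle : (bonusEdgeCoins hact hG htame M σ γ x).card ≤ T := by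
    refine le_trans Finset.card_image_le (le_trans ?_ hT)
    refine le_trans (Finset.card_union_le _ _) (Nat.add_le_add ?_ ?_)
    · exact Finset.card_filter_le _ _
    · exact le_trans Finset.card_image_le (by rw [Finset.card_attach])
  rw [bonusCoins, Finset.card_union_of_disjoint (disjoint_bonusEdgeCoins_padCoins σ γ x _ _), card_padCoins]
  omega

/-! #### Geometry of the read edges -/

/-- Edges of `Z(x)` are edges of `𝒢` whose endpoints project into `B_r(π x)`. [cite: MartineauSevero2019, Lemma 5.1 (Z ⊆ π⁻¹(B_r(π(x))))] -/
theorem zEdges_spec {x : V} {f : Sym2 V} (hf : f ∈ zEdges hact hG htame x) :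
    f ∈ G.edgeSet ∧ ∀ z ∈ f, qmk Γ z ∈ graphBall (orbitQuotientGraph G Γ) (qmk Γ x) r := by
  rw [zEdges, Finset.mem_union] at hf
  rcases hf with hf | hf
  · rw [List.mem_toFinset] at hf
    exact ⟨(tameLift htame x).walk.edges_subset_edgeSet hf, fun z hz => (tameLift htame x).proj_mem_of_mem_edges hf hz⟩
  · obtain ⟨b, -, hb⟩ := Finset.mem_biUnion.1 hf
    rcases Finset.mem_union.1 hb with hb | hb
    · rw [List.mem_toFinset] at hb
      exact ⟨(sphereBLift hact hG x b).walk.edges_subset_edgeSet hb,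
        fun z hz => (sphereBLift hact hG x b).proj_mem_of_mem_edges hb hz⟩
    · rw [List.mem_toFinset] at hb
      refine ⟨(smulWalk hact _ _).edges_subset_edgeSet hb, fun z hz => ?_⟩
      exact qmk_mem_graphBall_of_mem_edges_smulWalk hact _ (sphereBLift hact hG x b).walk
        (sphereBLift hact hG x b).length_le hb hz

/-- The boundary edge read for `b` is one of the two boundary lifts. [cite: MartineauSevero2019, §5] -/
theorem boundaryChoice_eq_or (σ : EState (MulAction.orbitRel.Quotient Γ V)) (γ : GState V Γ) (x : V)
    (b : ↥(sphereFin (orbitQuotientGraph G Γ) (qmk Γ x) (r + 1))) :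
    (boundaryChoice hact hG htame σ γ x b = (sphereBLift hact hG x b).edge₁ ∧
        boundaryFar hact hG htame σ γ x b = (sphereBLift hact hG x b).far ∧
        ¬ IsDesig σ γ (sphereBLift hact hG x b).edge₁) ∨
      (boundaryChoice hact hG htame σ γ x b = (sphereBLift hact hG x b).edge₂ (tameLift htame x).g ∧
        boundaryFar hact hG htame σ γ x b = (tameLift htame x).g • (sphereBLift hact hG x b).far ∧
        IsDesig σ γ (sphereBLift hact hG x b).edge₁) := by
  unfold boundaryChoice boundaryFar
  by_cases h : IsDesig σ γ (sphereBLift hact hG x b).edge₁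
  · exact Or.inr ⟨by rw [if_pos h], by rw [if_pos h], h⟩
  · exact Or.inl ⟨by rw [if_neg h], by rw [if_neg h], h⟩

/-- The boundary edge read for `b` is an edge of `𝒢` whose endpoints project into `B_{r+1}(π x)`, it projects
to the `ℋ`-edge of the boundary lift, and it joins a vertex `z₀` with `π z₀ ∈ B_r(π x)`, reached from `x` or from
`g x` along `Z(x)`, to the far endpoint, which lies above `b`. [cite: MartineauSevero2019, Lemma 5.1, §5] -/
theorem boundaryChoice_spec (σ : EState (MulAction.orbitRel.Quotient Γ V)) (γ : GState V Γ) (x : V)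
    (b : ↥(sphereFin (orbitQuotientGraph G Γ) (qmk Γ x) (r + 1))) :
    boundaryChoice hact hG htame σ γ x b ∈ G.edgeSet ∧
      (∀ z ∈ boundaryChoice hact hG htame σ γ x b, qmk Γ z ∈ graphBall (orbitQuotientGraph G Γ) (qmk Γ x) (r + 1)) ∧
      Sym2.map (qmk Γ) (boundaryChoice hact hG htame σ γ x b) = (sphereBLift hact hG x b).hedge ∧
      qmk Γ (boundaryFar hact hG htame σ γ x b) = b.1 := by
  have hb : (orbitQuotientGraph G Γ).dist (qmk Γ x) b.1 = r + 1 := (mem_sphereFin_iff (quot_connected hG)).1 b.2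
  set β := sphereBLift hact hG x b with hβ
  rcases boundaryChoice_eq_or (hact := hact) (hG := hG) (htame := htame) σ γ x b with ⟨h1, h2, -⟩ | ⟨h1, h2, -⟩
  · rw [h1, h2]
    exact ⟨β.edge₁_mem_edgeSet, fun z hz => β.proj_mem_of_mem_edge₁ hG hb hz, β.map_edge₁, β.far_proj⟩
  · rw [h1, h2]
    exact ⟨β.edge₂_mem_edgeSet hact _, fun z hz => β.proj_mem_of_mem_edge₂ hG hb _ hz, β.map_edge₂ _,
      (β.smul_far_spec hact _).2⟩

/-- Every edge read by a bonus is an edge of `𝒢` whose endpoints project into `B_{r+1}(π x)`.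
[cite: MartineauSevero2019, §5 (Condition 4)] -/
theorem bonusEdgeSet_spec {σ : EState (MulAction.orbitRel.Quotient Γ V)} {γ : GState V Γ} {x : V} {f : Sym2 V}
    (hf : f ∈ bonusEdgeSet hact hG htame σ γ x) :
    f ∈ G.edgeSet ∧ ∀ z ∈ f, qmk Γ z ∈ graphBall (orbitQuotientGraph G Γ) (qmk Γ x) (r + 1) := by
  rw [bonusEdgeSet, Finset.mem_union] at hf
  rcases hf with hf | hf
  · obtain ⟨hf, -⟩ := Finset.mem_filter.1 hf
    obtain ⟨h1, h2⟩ := zEdges_spec hf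
    exact ⟨h1, fun z hz => graphBall_mono _ _ (Nat.le_succ r) (h2 z hz)⟩
  · obtain ⟨b, -, rfl⟩ := Finset.mem_image.1 hf
    obtain ⟨h1, h2, -⟩ := boundaryChoice_spec (hact := hact) (hG := hG) (htame := htame) σ γ x b
    exact ⟨h1, h2⟩

/-- The bonus centre lies in `B_{r+1}` of the anchor of every edge it reads (the domain of injectivity of
`copyIdx`). [cite: MartineauSevero2019, §5 (Condition 4)] -/
theorem center_mem_ballFin_anchor {σ : EState (MulAction.orbitRel.Quotient Γ V)} {γ : GState V Γ} {x : V}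
    {f : Sym2 V} (hf : f ∈ bonusEdgeSet hact hG htame σ γ x) :
    qmk Γ x ∈ ballFin (orbitQuotientGraph G Γ) (anchor Γ f) (r + 1) := by
  obtain ⟨z, hz, hza⟩ := exists_mem_anchor_eq (Γ := Γ) f
  rw [mem_ballFin, hza]
  exact mem_graphBall_symm ((bonusEdgeSet_spec hf).2 z hz)

end Bonus

/-! ### Encoding, bookkeeping step, replay and strategy -/

section Strategy

/-- The designated lift of the `ℋ`-edge `s(u,v)` when queried from `u`: the edge from the current lift of `u` to
its chosen neighbour above `v`. [cite: MartineauSevero2019, §5 ("pick e' some lift of e intersecting π⁻¹({u}) ∩ C'")] -/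
def newLift (G : SimpleGraph V) (γ : GState V Γ) (u v : MulAction.orbitRel.Quotient Γ V) : Sym2 V :=
  s(γ.lift u, nbrOver G (γ.lift u) v)

variable {G : SimpleGraph V} [(orbitQuotientGraph G Γ).LocallyFinite]
variable (hact : IsActionByAut G Γ) (hG : G.Connected) {r : ℕ}
variable (htame : ∀ x : V, ∃ g : Γ, g ≠ 1 ∧ g • x ∈ graphBall G x r) (M T : ℕ) [NeZero M]
variable (x₀ : V) (L : ℕ)

/-- **The `𝒢`-side encoding of a query**: an edge query reads the `M` copies of the new designated lift
("for every `k ≤ M`, define `η_{(e',k)} := ω_{(e,k)}`"), a bonus reads the bonus coins at the lift of its centre.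
[cite: MartineauSevero2019, §5 (Steps 2K+1, 2K+2 on 𝒢)] -/
def gEncode (σ : EState (MulAction.orbitRel.Quotient Γ V)) (γ : GState V Γ) :
    EQuery (MulAction.orbitRel.Quotient Γ V) → CoinQuery (GCoin V M)
  | EQuery.edge u v => ⟨copyCoins M (newLift G γ u v), false⟩
  | EQuery.bonus u => ⟨bonusCoins hact hG htame M T σ γ (γ.lift u), true⟩

/-- **One step of the bookkeeping**: an open edge query lifts its far endpoint (if newly explored) along the
designated lift; a successful bonus lifts the newly explored vertices of `S_{r+1}(u)` along the boundary edges
read; the pool counter advances by the number of padding coins used.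
[cite: MartineauSevero2019, §5 (C'_{2K+1,n+1} := C' ∪ e'; C'_{2K+2,n+1} := C' ∪ Z ∪ the e''s)] -/
def gstep (σ : EState (MulAction.orbitRel.Quotient Γ V)) (γ : GState V Γ) :
    EQuery (MulAction.orbitRel.Quotient Γ V) → Bool → GState V Γ
  | EQuery.edge u v, a =>
    { lift := if a then (if v ∈ σ.A then γ.lift else Function.update γ.lift v (nbrOver G (γ.lift u) v)) else γ.lift
      dl := Function.update γ.dl s(u, v) (newLift G γ u v)
      pool := γ.pool }
  | EQuery.bonus u, a =>
    { lift := if a then fun w =>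
          if hw : w ∈ sphereFin (orbitQuotientGraph G Γ) (qmk Γ (γ.lift u)) (r + 1) then
            (if w ∈ σ.A then γ.lift w else boundaryFar hact hG htame σ γ (γ.lift u) ⟨w, hw⟩)
          else γ.lift w
        else γ.lift
      dl := γ.dl
      pool := γ.pool + (T - (bonusEdgeCoins hact hG htame M σ γ (γ.lift u)).card) }

/-- **The bookkeeping after a transcript**: replay, in lockstep with the `ℋ`-level machine.
[cite: MartineauSevero2019, §5] -/
def gstateOf : List Bool → GState V Γ
  | [] => GState.init x₀
  | a :: b => match enq (orbitQuotientGraph G Γ) r (qmk Γ x₀) L (estateOf (orbitQuotientGraph G Γ) r (qmk Γ x₀) L b) with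
    | none => gstateOf b
    | some q => gstep hact hG htame M T (estateOf (orbitQuotientGraph G Γ) r (qmk Γ x₀) L b) (gstateOf b) q a

/-- **The `𝒢`-side strategy**: the same machine, queries encoded on the cover.
[cite: MartineauSevero2019, §5 (the exploration process building η on Ĝ)] -/
def gStrategy : CoinStrategy (GCoin V M) :=
  ⟨fun b => (enq (orbitQuotientGraph G Γ) r (qmk Γ x₀) L (estateOf (orbitQuotientGraph G Γ) r (qmk Γ x₀) L b)).map
    (gEncode hact hG htame M T (estateOf (orbitQuotientGraph G Γ) r (qmk Γ x₀) L b) (gstateOf hact hG htame M T x₀ L b))⟩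

variable {hact hG htame M T x₀ L}

/-- Replay of a cons. [folklore] -/
theorem gstateOf_cons (a : Bool) (b : List Bool) :
    gstateOf hact hG htame M T x₀ L (a :: b) =
      match enq (orbitQuotientGraph G Γ) r (qmk Γ x₀) L (estateOf (orbitQuotientGraph G Γ) r (qmk Γ x₀) L b) with
      | none => gstateOf hact hG htame M T x₀ L b
      | some q => gstep hact hG htame M T (estateOf (orbitQuotientGraph G Γ) r (qmk Γ x₀) L b)
          (gstateOf hact hG htame M T x₀ L b) q a := rfl

/-- The next query of the `𝒢`-side strategy. [folklore] -/
theorem gStrategy_next (b : List Bool) :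
    (gStrategy hact hG htame M T x₀ L).next b =
      (enq (orbitQuotientGraph G Γ) r (qmk Γ x₀) L (estateOf (orbitQuotientGraph G Γ) r (qmk Γ x₀) L b)).map
        (gEncode hact hG htame M T (estateOf (orbitQuotientGraph G Γ) r (qmk Γ x₀) L b) (gstateOf hact hG htame M T x₀ L b)) :=
  rfl

/-- **Equal shapes**: after every transcript the `𝒢`-query and the `ℋ`-query both halt or have the same kind and
number of coins (`M` for an edge, `T` for a bonus). [cite: MartineauSevero2019, §5 (Proposition 4.1: the coupling is well defined)] -/
theorem shape_gStrategy_eq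
    (hT : ∀ x : V, (zEdges hact hG htame x).card + (sphereFin (orbitQuotientGraph G Γ) (qmk Γ x) (r + 1)).card ≤ T)
    (b : List Bool) :
    ((gStrategy hact hG htame M T x₀ L).next b).map CoinQuery.shape =
      ((hStrategy (orbitQuotientGraph G Γ) r (qmk Γ x₀) L M T).next b).map CoinQuery.shape := by
  rw [gStrategy_next, hStrategy_next, Option.map_map, Option.map_map]
  cases enq (orbitQuotientGraph G Γ) r (qmk Γ x₀) L (estateOf (orbitQuotientGraph G Γ) r (qmk Γ x₀) L b) with
  | none => rfl
  | some q =>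
    simp only [Option.map_some, Function.comp_apply]
    cases q with
    | edge u v => simp [gEncode, hEncode, CoinQuery.shape]
    | bonus u => simp [gEncode, hEncode, CoinQuery.shape, card_bonusCoins _ _ _ (hT _)]

/-- The answer to an encoded edge query is "the new designated lift is open in `gOmega c`". [cite: MartineauSevero2019, §5] -/
theorem answer_gEncode_edge (σ : EState (MulAction.orbitRel.Quotient Γ V)) (γ : GState V Γ)
    (u v : MulAction.orbitRel.Quotient Γ V) (c : Set (GCoin V M)) :
    (gEncode hact hG htame M T σ γ (EQuery.edge u v)).answer c = decide (newLift G γ u v ∈ gOmega c) := by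
  simp [gEncode, CoinQuery.answer, gOmega]

/-- A positive answer to an encoded bonus opens every edge read. [cite: MartineauSevero2019, §5 ("If all these newly s-explored edges are open")] -/
theorem mem_gOmega_of_answer_bonus {σ : EState (MulAction.orbitRel.Quotient Γ V)} {γ : GState V Γ}
    {u : MulAction.orbitRel.Quotient Γ V} {c : Set (GCoin V M)}
    (ha : (gEncode hact hG htame M T σ γ (EQuery.bonus u)).answer c = true) {f : Sym2 V}
    (hf : f ∈ bonusEdgeSet hact hG htame σ γ (γ.lift u)) : f ∈ gOmega c := by
  simp only [gEncode, CoinQuery.answer, if_true, decide_eq_true_eq] at ha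
  refine ⟨copyIdx (orbitQuotientGraph G Γ) r M (anchor Γ f) (qmk Γ (γ.lift u)), ha _ ?_⟩
  rw [bonusCoins, Finset.mem_union]
  exact Or.inl (Finset.mem_image.2 ⟨f, hf, rfl⟩)

end Strategy

end Literature.Probability.Percolation
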